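import Mathlib
import HarnessLib
import Literature.Analysis.FluidPDE.TypeIAncientMild
import Literature.Analysis.FluidPDE.SelfSimilar
import Literature.Analysis.FluidPDE.TaoClassGlue
import Literature.Analysis.FluidPDE.EnstrophyGronwall
import Summits.NavierStokesRegularity.NavierStokesRegularity.Theorems.QuarterLogPincerThinCascadeDefs
import Summits.NavierStokesRegularity.NavierStokesRegularity.Theorems.QuarterLogPincerTruncationEdgeDivFreeTruncation
import Summits.NavierStokesRegularity.NavierStokesRegularity.Theorems.QuarterLogPincerTruncationEdgeShadowExistence

/-!
# Route `QuarterLogPincer`, crux `TypeIQuantSubcubicExp` (stmt-NavierStokesRegularity-24077), line `truncation_edge`: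
# STUB T1 `stub_farFieldTruncation` WITHOUT ITS `L³` CLAUSE — the truncation exists, is Type-I, and shadows `v`

Assembly of the typer's four groundwork files (pub-ns-dss typer g35; helper `--supports stmt-NavierStokesRegularity-24077`):
`…TruncationEdgeOseenStability` (p664453), `…DivFreeTruncation` (p665196), `…Shadowing`, `…ShadowExistence`.

`farFieldTruncation_shadow`: for an enveloped Type-I ancient mild field (`IsTypeIAncientMild M v`, `HasTypeIDecay A v`) and every
accuracy `δ ∈ (0,1]` there are `κ ≥ 0`, `K ≥ 1` such that for every `ε ∈ (0,½]` some radius `2 ≤ R ≤ Kε^{−κ}` and some TAO-FRAME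
solution `(u,p)` on `[0, 1−ε]` satisfy the virtual Type-I bound `‖u(t,x)‖ ≤ (M+1)(1−ε+ε−t)^{−1/2}` and `‖u(1−ε,x) − v(−ε,x)‖ ≤ δ` on
`B(1)` — i.e. `FarFieldTruncation M v` of `Theorems/QuarterLogPincerTruncationEdgeDefs.lean` (stub T1 = `StubFarFieldTruncation`,
author ns-idea-7 g8) with clause (ii) (the log-size `L³` budget) REMOVED and everything else verbatim.

READING for the line / W7: the registered obligation T1 is now `T1 = (this theorem) ∧ (ii)`; the residual of the edge 24077 ⇒ 22144
over the envelope-class Liouville wall is CLAUSE (ii) ALONE — a two-region (barrier) estimate for the Oseen system around the Type-I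
drift (the typer's sizing note, evidence on stmt-24077).  HONEST FRAME: nothing here proves T1, 24077, 22144 or any statement about
Navier–Stokes regularity; all objects are hypothetical.
-/

noncomputable section

set_option linter.dupNamespace false

namespace Summit.NavierStokesRegularity.NavierStokesRegularity.Theorems.QuarterLogPincerTruncationEdge

open MeasureTheory Set Function Filter Real Metric
open scoped ENNReal NNReal Topology ContDiff
open Literature.Analysis Literature.Analysis.FluidPDE
open Summit.NavierStokesRegularity.NavierStokesRegularity.Cruxes.TypeIQuantSubcubicExp.ThinCascade (TaoFrame)

/-! ## T1 minus its `L³` clause: the truncation exists, obeys the virtual Type-I bound, and shadows `v` -/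

/-- `H^k`-finiteness of smooth compactly supported fields. [folklore] -/
theorem lintegral_iteratedFDeriv_sq_lt_top_of_hasCompactSupport
    {u₀ : EuclideanSpace ℝ (Fin 3) → EuclideanSpace ℝ (Fin 3)} (hu : ContDiff ℝ ∞ u₀) (hc : HasCompactSupport u₀)
    (n : ℕ) : ∫⁻ x, ‖iteratedFDeriv ℝ n u₀ x‖ₑ ^ 2 < ⊤ := by
  have hcont : Continuous (iteratedFDeriv ℝ n u₀) := hu.continuous_iteratedFDeriv (by exact_mod_cast le_top)
  have hcs : HasCompactSupport (iteratedFDeriv ℝ n u₀) := hc.iteratedFDeriv n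
  have hmem : MemLp (iteratedFDeriv ℝ n u₀) 2 (volume : Measure (EuclideanSpace ℝ (Fin 3))) :=
    hcont.memLp_of_hasCompactSupport hcs
  have := lintegral_rpow_enorm_lt_top_of_eLpNorm_lt_top (by norm_num) ENNReal.ofNat_ne_top hmem.2
  simpa using this

/-- **T1 WITHOUT CLAUSE (ii)** (`FarFieldTruncation M v` of `Theorems/QuarterLogPincerTruncationEdgeDefs.lean` with the `L³` clause
removed, otherwise VERBATIM): for an enveloped Type-I ancient mild field (`IsTypeIAncientMild M v`, `HasTypeIDecay A v`) and every
accuracy `δ ∈ (0,1]` there are `κ ≥ 0`, `K ≥ 1` such that for every `ε ∈ (0, ½]` some radius `2 ≤ R ≤ K ε^{−κ}` and some Tao-frame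
solution `(u, p)` on `[0, 1−ε]` satisfy the virtual Type-I bound `‖u(t,x)‖ ≤ (M+1)(1−ε+ε−t)^{−1/2}` and `‖u(1−ε,x) − v(−ε,x)‖ ≤ δ` on
`B(1)` (indeed on all of `ℝ³`).  ASSEMBLY of the typer's three pieces: the divergence-free truncated datum at radius
`R = 2KA·δ⁻¹(2/ε)^m + 2` (`exists_divFree_truncation`), the marched existence in Tao's class (`exists_isTaoSolutionOn_shadow`) and the
shadowing bound; `κ = m = ⌈64C²(M+1)²⌉`.  READING: the registered stub `StubFarFieldTruncation` = THIS ∧ its clause (ii) (the log-size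
`L³` budget of the truncation); the residual of the edge 24077 ⇒ 22144 is thereby clause (ii) alone (sizing note on 24077: a
barrier estimate for the Oseen system around the Type-I drift).  Nothing here proves T1, 24077, 22144 or anything about NS
regularity. [this file; line groundwork] -/
theorem farFieldTruncation_shadow {M A : ℝ}
    {v : ℝ → EuclideanSpace ℝ (Fin 3) → EuclideanSpace ℝ (Fin 3)}
    (hv : IsTypeIAncientMild M v) (hA : HasTypeIDecay A v) :
    ∀ δ : ℝ, 0 < δ → δ ≤ 1 → ∃ κ K : ℝ, 0 ≤ κ ∧ 1 ≤ K ∧ ∀ ε ∈ Set.Ioc (0 : ℝ) (1 / 2),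
      ∃ (R : ℝ) (u : ℝ → EuclideanSpace ℝ (Fin 3) → EuclideanSpace ℝ (Fin 3))
        (p : ℝ → EuclideanSpace ℝ (Fin 3) → ℝ),
        2 ≤ R ∧ R ≤ K * ε ^ (-κ) ∧ TaoFrame (1 - ε) u p ∧
        (∀ t ∈ Set.Icc 0 (1 - ε), ∀ x : EuclideanSpace ℝ (Fin 3),
            ‖u t x‖ ≤ (M + 1) * (1 - ε + ε - t) ^ (-(1 / 2 : ℝ))) ∧
        (∀ x ∈ Metric.ball (0 : EuclideanSpace ℝ (Fin 3)) 1, ‖u (1 - ε) x - v (-ε) x‖ ≤ δ) := by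
  obtain ⟨K, hK, htrunc⟩ := exists_divFree_truncation
  obtain ⟨C, hC, hexist⟩ := exists_isTaoSolutionOn_shadow
  intro δ hδ hδ1
  have hM : 0 ≤ M := hv.nonneg
  set m : ℕ := ⌈64 * C ^ 2 * (M + 1) ^ 2⌉₊ with hm
  -- the slice `v(−1)`: smooth, divergence free, enveloped
  have hv1s : ContDiff ℝ ∞ (v (-1)) := hv.contDiff_slice (by norm_num)
  have hv1d : ∀ y, VectorCalculus.divergence (v (-1)) y = 0 := hv.isDivFree (by norm_num)
  have hv1e : ∀ x, ‖v (-1) x‖ ≤ A / (‖x‖ + 1) := fun x => by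
    have := hA (-1) (by norm_num) x
    simpa using this
  have hA0 : 0 ≤ A := by
    have h := hv1e 0
    rw [norm_zero, zero_add, div_one] at h
    exact (norm_nonneg _).trans h
  -- constants
  refine ⟨m, 2 * K * A * 2 ^ m / δ + 2, Nat.cast_nonneg m, by
    have : 0 ≤ 2 * K * A * 2 ^ m / δ := by positivity
    linarith, ?_⟩
  intro ε hε
  have hε0 : 0 < ε := hε.1
  have hε2 : ε ≤ 1 / 2 := hε.2
  set F : ℝ := 1 - ε with hF
  have hF0 : 0 < F := by rw [hF]; linarith
  have hF1 : F < 1 := by rw [hF]; linarith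
  set L : ℝ := (2 / ε) ^ m with hL
  have hL1 : 1 ≤ L := one_le_pow₀ (by rw [le_div_iff₀ hε0]; linarith)
  set R : ℝ := 2 * K * A * L / δ + 2 with hR
  have hR2 : 2 ≤ R := by
    have : 0 ≤ 2 * K * A * L / δ := by positivity
    rw [hR]; linarith
  have hRpos : 0 < R := by linarith
  -- the datum
  obtain ⟨u₀, hu₀s, hu₀d, hu₀c, -, -, hu₀err⟩ := htrunc hv1s hv1d hA0 hv1e hRpos
  set η : ℝ := K * A / R with hη
  have hη0 : 0 ≤ η := by positivity
  have hηL : η * L ≤ δ / 2 := by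
    -- `η L = K A L / R ≤ K A L / (2 K A L / δ) = δ/2` (and trivially if `A = 0`)
    rw [hη]
    rcases eq_or_lt_of_le hA0 with hA00 | hApos
    · rw [← hA00]; simp
      positivity
    · have hden : 0 < 2 * K * A * L / δ := by positivity
      have h1 : K * A / R ≤ K * A / (2 * K * A * L / δ) :=
        div_le_div_of_nonneg_left (by positivity) hden (by rw [hR]; linarith)
      calc K * A / R * L ≤ K * A / (2 * K * A * L / δ) * L := mul_le_mul_of_nonneg_right h1 (by positivity)
        _ = δ / 2 := by field_simp
  have hsmall : η * (2 / (1 - F)) ^ m ≤ 1 / 2 := by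
    have e : 1 - F = ε := by rw [hF]; ring
    rw [e, ← hL]
    linarith
  -- energies of the datum
  have hH : ∀ n : ℕ, ∫⁻ x, ‖iteratedFDeriv ℝ n u₀ x‖ₑ ^ 2 < ⊤ :=
    lintegral_iteratedFDeriv_sq_lt_top_of_hasCompactSupport hu₀s hu₀c
  have he_fin : ∫⁻ x, ‖u₀ x‖ₑ ^ 2 < ⊤ := by
    have h0 := hH 0
    have e : ∫⁻ x, ‖iteratedFDeriv ℝ 0 u₀ x‖ₑ ^ 2 = ∫⁻ x, ‖u₀ x‖ₑ ^ 2 :=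
      lintegral_congr fun x => by rw [← ofReal_norm, norm_iteratedFDeriv_zero, ofReal_norm]
    rwa [e] at h0
  have hg_fin : ∫⁻ x, ENNReal.ofReal (frobeniusNormSq (fderiv ℝ u₀ x)) < ⊤ := by
    have hDc : Continuous (fderiv ℝ u₀) := hu₀s.continuous_fderiv (by simp)
    have hDs : HasCompactSupport (fderiv ℝ u₀) := hu₀c.fderiv (𝕜 := ℝ)
    have hmem : MemLp (fderiv ℝ u₀) 2 (volume : Measure (EuclideanSpace ℝ (Fin 3))) :=
      hDc.memLp_of_hasCompactSupport hDs
    have hD2 : ∫⁻ x, ‖fderiv ℝ u₀ x‖ₑ ^ 2 < ⊤ := by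
      have := lintegral_rpow_enorm_lt_top_of_eLpNorm_lt_top (by norm_num) ENNReal.ofNat_ne_top hmem.2
      simpa using this
    calc ∫⁻ x, ENNReal.ofReal (frobeniusNormSq (fderiv ℝ u₀ x))
        ≤ ∫⁻ x, 3 * ‖fderiv ℝ u₀ x‖ₑ ^ 2 := lintegral_mono fun x => ofReal_frobeniusNormSq_le_three_mul_enorm_sq _
      _ = 3 * ∫⁻ x, ‖fderiv ℝ u₀ x‖ₑ ^ 2 := by rw [lintegral_const_mul' _ _ (by norm_num)]
      _ < ⊤ := ENNReal.mul_lt_top (by norm_num) hD2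
  set e₀ : ℝ := (∫⁻ x, ‖u₀ x‖ₑ ^ 2).toReal with he₀
  set g₀ : ℝ := (∫⁻ x, ENNReal.ofReal (frobeniusNormSq (fderiv ℝ u₀ x))).toReal with hg₀
  have he₀' : ∫⁻ x, ‖u₀ x‖ₑ ^ 2 ≤ ENNReal.ofReal e₀ := by rw [he₀, ENNReal.ofReal_toReal he_fin.ne]
  have hg₀' : ∫⁻ x, ENNReal.ofReal (frobeniusNormSq (fderiv ℝ u₀ x)) ≤ ENNReal.ofReal g₀ := by
    rw [hg₀, ENNReal.ofReal_toReal hg_fin.ne]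
  have hηu : ∀ y, ‖u₀ y - v (-1) y‖ ≤ η := fun y => by rw [hη]; exact hu₀err y
  -- existence + shadowing on `[0, 1−ε]`
  obtain ⟨u, p, hsol, hbd⟩ := hexist hv hM hu₀s hu₀d hH ENNReal.toReal_nonneg he₀' ENNReal.toReal_nonneg hg₀'
    hF0 hF1 hηu hsmall
  refine ⟨R, u, p, hR2, ?_, taoFrame_of_isTaoSolutionOn hsol, ?_, ?_⟩
  · -- `R ≤ K' ε^{−m}`
    have hpow : ε ^ (-(m:ℝ)) = (1 / ε) ^ m := by
      rw [Real.rpow_neg hε0.le, Real.rpow_natCast, one_div, inv_pow]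
    rw [hpow]
    have h1 : (1:ℝ) ≤ (1 / ε) ^ m := one_le_pow₀ (by rw [le_div_iff₀ hε0]; linarith)
    have hLe : L = 2 ^ m * (1 / ε) ^ m := by rw [hL, ← mul_pow]; congr 1; ring
    rw [hR, hLe]
    have h2 : (0:ℝ) ≤ 2 * K * A * 2 ^ m / δ := by positivity
    calc 2 * K * A * (2 ^ m * (1 / ε) ^ m) / δ + 2
        = (2 * K * A * 2 ^ m / δ) * (1 / ε) ^ m + 2 := by ring
      _ ≤ (2 * K * A * 2 ^ m / δ) * (1 / ε) ^ m + 2 * (1 / ε) ^ m := by nlinarith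
      _ = (2 * K * A * 2 ^ m / δ + 2) * (1 / ε) ^ m := by ring
  · -- the virtual Type-I bound
    intro t ht x
    have h := (hbd t ht x).2
    have e : (1 - ε + ε - t) = 1 - t := by ring
    rw [e, Real.rpow_neg (by linarith [ht.2]), ← Real.sqrt_eq_rpow, ← div_eq_mul_inv]
    exact h
  · -- closeness at the final time
    intro x _
    have h := (hbd F ⟨hF0.le, le_rfl⟩ x).1
    have e1 : F - 1 = -ε := by rw [hF]; ring
    have e2 : 1 - F = ε := by rw [hF]; ring
    rw [e1, e2, ← hL] at h
    have : η * L ≤ δ := hηL.trans (by linarith)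
    exact h.trans this

end Summit.NavierStokesRegularity.NavierStokesRegularity.Theorems.QuarterLogPincerTruncationEdge

end
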